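import Literature.AnabelianGeometry.EtaleTheta.FrobenioidCyclotomicRigidity
import Literature.AnabelianGeometry.EtaleTheta.FrobenioidMonoTheta

/-!
# [EtTh] Prop. 5.5 / Thm. 5.6 (i) — sub-DAG statements (PDF pp. 101–103 = printed 327–329)

Mochizuki, *The étale theta function and its Frobenioid-theoretic manifestations*, Publ. RIMS **45**
(2009) [cite: MochizukiEtTh2009, Prop 5.5 p.327 (PDF p.101); Thm 5.6 p.328 (PDF p.102)].  abc-iut cell,
layer L2, §K row K4 «SUBDAG EtTh:Thm5.6(i)+Prop5.5» (seat abc-iut-w5-d020 gen 2; plan/L2/SUBDAG-EtTh-Thm56.md,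
staged HOME/staging/w5/w5-d020/subdag/).  STATEMENTS-FIRST over the BUILT §5 vocabulary of abc-iut-L2-t4
(`ThetaFrobenioid`, `FrobenioidCyclotomicRigidity.{ThetaSubquotientProj, RigidityFamily, IsKummerDetermined,
IsFunctorialLinear, LinearlyReachableFromBN, CyclotomicRigidity (= Prop. 5.5), CyclotomicRigidityPreserved
(= Thm. 5.6)}` — the statements of record, NOT restated) and `FrobenioidThetaBiKummer.ThetaPairKummerClass`
(Prop. 5.2 (iii), cocycle form; the `(η, ν)` pin = L2 MERGE-PLAN row 6, W3-L2-01 data, not re-typed).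

What this file adds are the INTERMEDIATE statements of the printed proofs that are not yet decls — each a
`Prop`-valued PREDICATE on the §5 data `𝔉 : ThetaFrobenioid C D` (never a zero-argument fact, D-0067 (5)),
docstring = sub-node id + print locator + the owner of its eventual instance:
* Prop. 5.5 proof (p.327 l.−6 – p.328 l.11): `EtaTautological` (P55-L02: «it follows from the detailed
  description of the "étale theta class" in Proposition 1.3 …» = `η̈^Θ|_{Δ_Θ} = log(Θ)` read mod `N` on the part
  of `H_{B_N}` over `(l·Δ_Θ)_{B_N}`), `UnitsCentralUnderLDelta` (P55-L02b / T56-L09b: the lifts `s^⊓-gp_N(g)` of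
  the part of `Aut_D(B_N^bs)` over `(l·Δ_Θ)_{B_N}` commute with `O^×(B_N)` — «the Kummer class of the "constant
  function" `u` does not affect the restriction … to `(l·Δ_Θ)`», p.329), `TransportIndependent` (P55-L06,
  «independent of the choice of `S″`, `S‴` and the linear morphisms», p.328), the functoriality / commutation LAWS
  of the stub transports `unitsPull`, `lDeltaMap` (P55-L06b, T56-L09d; data without laws in `FrobenioidTheta`),
  `BijectivelyReachableFromBN` (P55-L05 with «induce isomorphisms»);
* Thm. 5.6 proof (p.328 l.−5 – p.329 l.−9): `IsCharacteristicBase` (T56-L05 «`S₂^bs` is "characteristic"»),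
  `DeltaTransportCompat` (T56-L09c: at `B_N` the transport of `(l·Δ_Θ) ⊗ ℤ/Nℤ` induced by `Ψ` — abc-iut-L2-d4's
  parameter `aΨ` — read through `β : Ψ(B_N) ⥲ B_N` is induced by the base transport `θ` of abc-iut-L2-t4's
  `StrvTransport`; Props. 2.4, 2.6);
and two short DERIVATIONS: P55-L03 `isKummerDetermined_of_thetaPair` (the EXISTENCE half of Prop. 5.5 at the
codomain `B_N`: abc-iut-L2-t4's `IsKummerDetermined` holds for every family extending `ν`, from Prop. 5.2 (iii) +
`EtaTautological` + `UnitsCentralUnderLDelta`) and `muTorsionPull_iso_eq` (T56-L09d: along an isomorphism the unit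
pull-back is conjugation).  The longer derivations (T56-L09 = abc-iut-L2-d4's binder `hBN` of
`Discharge/Sec5Thm56.cyclotomicRigidityPreserved_of`; P55-A) go to the proof-only companion
`Thm56SubdagProofs.lean`.
HONEST FRAMING: [EtTh] is a refereed paper; nothing of it is asserted here; typed ≠ proved; an "OPEN at the model"
row becomes dischargeable exactly when W3-L2-01 (`ThetaFrobenioid.ofSetting`) instantiates the §5 data; no side is
taken on any disputed claim downstream ([IUTchIII] Cor. 3.12).
-/

namespace Literature.AnabelianGeometry.EtaleTheta

open CategoryTheory
open FrobenioidCyclotomicRigidity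

universe w v v' u u'

namespace ThetaFrobenioid

namespace Thm56Sub

variable {C : Type u} [Category.{v} C] {D : Type u'} [Category.{v'} D] (𝔉 : ThetaFrobenioid.{w} C D)

/-! ### Prop. 5.5 — the existence half at the `l·N`-codomain `B_N` (proof p.327 l.−6 – p.328 l.1) -/

/-- **EtTh:Prop5.5/P55-L02** (p.327 (PDF p.101) l.−3 – p.328 l.1: «it follows from the detailed description of
the "étale theta class" in Proposition 1.3 that the resulting Kummer class [cf. Proposition 5.2, (iii)]
determines an isomorphism `(l·Δ_Θ)_{S″} ⊗ ℤ/Nℤ ⥲ μ_N(S″)`»).  CONTENT of the appeal to Prop. 1.3 (= Prop. 1.5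
(iii): `η̈^Θ` restricts on `Δ_Θ` to the identity class `log(Θ)`, abc-iut-L2-t1 `ThetaSetting.logTheta` /
`ThetaCohomology.Prop15iii`), read mod `N` on `H_{B_N}`: on the part `P.pre` of `H_{B_N}` lying over
`(l·Δ_Θ)_{B_N}` the cocycle `η` of Prop. 5.2 (iii) (MERGE-PLAN row 6 pin) IS the projection `h ↦ [proj h]`.
OPEN at the model (owner ∅; W3-L2-01 / row 6). [cite: MochizukiEtTh2009, Prop 5.5 proof p.327 (PDF p.101)] -/
def EtaTautological (P : ThetaSubquotientProj 𝔉) (η : 𝔉.HB → 𝔉.lDeltaModN 𝔉.BN) : Prop :=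
  ∀ (h : 𝔉.HB) (hh : (h : Aut (𝔉.base.obj 𝔉.BN)) ∈ P.pre (𝔉.base.obj 𝔉.BN)),
    η h = QuotientGroup.mk (P.proj _ ⟨h, hh⟩)

/-- **EtTh:Thm5.6(i)/T56-L09b** (= **EtTh:Prop5.5/P55-L02b**) (p.329 (PDF p.103) l.19–21: «observing that the
Kummer class of the "constant function" `u` does not affect the restriction of the resulting Kummer classes to
`(l·Δ_Θ)_{S₂}`, `(l·Δ_Θ)_{T₂}`»): for `g ∈ Aut_D(B_N^bs)` in the part `P.pre` over `(l·Δ_Θ)_{B_N}` — the image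
of the GEOMETRIC fundamental group (§1 p.238 (PDF p.12): `l·Δ_Θ ⊆ Δ^tp_X` and `Ker(Π^tp_X ↠ (Π^tp_X)^Θ) ⊆
Δ^tp_X`) — the lift `s^⊓-gp_N(g) ∈ Aut_C(B_N)` COMMUTES with the units `O^×(B_N)` (the constants of the tempered
Frobenioid, on which the geometric fundamental group acts trivially; cf. Lemma 5.8 p.331: the units on which
`Π^tp_Y` acts through `μ_N` are `(O_K^×)^{1/N}`, abc-iut-L2-t4 `ConstantsActByCyclotome`).  Equivalently (d4
`kummerCocycle_eq_one_iff`) the Kummer cocycle of every unit is trivial on that part.  OPEN at the model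
(owner ∅; W3-L2-01).  [cite: MochizukiEtTh2009, Thm 5.6 proof p.329 (PDF p.103); §1 p.238 (PDF p.12)] -/
def UnitsCentralUnderLDelta (P : ThetaSubquotientProj 𝔉) : Prop :=
  ∀ g ∈ P.pre (𝔉.base.obj 𝔉.BN), ∀ u ∈ 𝔉.units 𝔉.BN, 𝔉.sgpCap g * u = u * 𝔉.sgpCap g

/-- **P55-L02b, cyclotome form**: the lifts `s^⊓-gp_N(g)`, `g` over `(l·Δ_Θ)_{B_N}`, commute with `μ_N(B_N)`.
[cite: MochizukiEtTh2009, Prop 5.5 proof p.327 (PDF p.101)] -/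
def CyclotomeCentralUnderLDelta (P : ThetaSubquotientProj 𝔉) : Prop :=
  ∀ g ∈ P.pre (𝔉.base.obj 𝔉.BN), ∀ u ∈ 𝔉.muTorsion 𝔉.BN 𝔉.N, 𝔉.sgpCap g * u = u * 𝔉.sgpCap g

/-- `μ_N(B_N) ⊆ O^×(B_N)`, so `UnitsCentralUnderLDelta ⇒ CyclotomeCentralUnderLDelta`.
[cite: MochizukiEtTh2009, Prop 5.5 proof p.327 (PDF p.101)] -/
theorem cyclotomeCentral_of_unitsCentral {P : ThetaSubquotientProj 𝔉} (h : UnitsCentralUnderLDelta 𝔉 P) :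
    CyclotomeCentralUnderLDelta 𝔉 P :=
  fun g hg u hu => h g hg u (𝔉.muTorsion_le_units 𝔉.BN 𝔉.N hu)

/-- The `s^⊔-gp_N`-lifts commute with the units as well, on the part over `(l·Δ_Θ)_{B_N}`: `s^⊔-gp_N(h) =
d(h)⁻¹ · s^⊓-gp_N(h)` with `d(h) := s^⊓-gp_N(h)·s^⊔-gp_N(h)⁻¹ ∈ μ_N(B_N) ⊆ O^×(B_N)` (Prop. 4.3 (iii), abc-iut-L2-t4's
`BiKummerDifferenceMem`) and `O^×(B_N)` is abelian ([FrdI] Rmk. 1.3.1).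
[cite: MochizukiEtTh2009, Thm 5.6 proof p.329 (PDF p.103)] -/
theorem sgpCup_comm_units_of {P : ThetaSubquotientProj 𝔉} (hc : UnitsCentralUnderLDelta 𝔉 P)
    (hdiff : 𝔉.BiKummerDifferenceMem) (h : 𝔉.HB)
    (hh : (h : Aut (𝔉.base.obj 𝔉.BN)) ∈ P.pre (𝔉.base.obj 𝔉.BN)) {u : Aut 𝔉.BN} (hu : u ∈ 𝔉.units 𝔉.BN) :
    𝔉.sgpCup h * u = u * 𝔉.sgpCup h := by
  have hd : 𝔉.sgpCap (h : Aut (𝔉.base.obj 𝔉.BN)) * (𝔉.sgpCup h)⁻¹ ∈ 𝔉.units 𝔉.BN :=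
    𝔉.muTorsion_le_units 𝔉.BN 𝔉.N ((𝔉.biKummerDifferenceMem_iff.mp hdiff) h)
  set d := 𝔉.sgpCap (h : Aut (𝔉.base.obj 𝔉.BN)) * (𝔉.sgpCup h)⁻¹ with hd_def
  have hcup : 𝔉.sgpCup h = d⁻¹ * 𝔉.sgpCap (h : Aut (𝔉.base.obj 𝔉.BN)) := by
    rw [hd_def, mul_inv_rev, inv_inv, inv_mul_cancel_right]
  have hcomm : d⁻¹ * u = u * d⁻¹ :=
    setLike_mul_comm (s := 𝔉.units 𝔉.BN) ((𝔉.units 𝔉.BN).inv_mem hd) hu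
  rw [hcup, mul_assoc, hc _ hh u hu, ← mul_assoc, hcomm, mul_assoc]

/-- **EtTh:Prop5.5/P55-L03 — Prop. 5.5, EXISTENCE at the codomain `B_N`, DERIVED** (p.327 l.−6 – p.328 l.1:
«… the resulting Kummer class … determines an isomorphism `(l·Δ_Θ)_{S″} ⊗ ℤ/Nℤ ⥲ μ_N(S″)`»): if the bi-Kummer
difference cocycle is `ν ∘ η` up to a `μ_N(B_N)`-coboundary (Prop. 5.2 (iii), abc-iut-L2-t4's
`ThetaPairKummerClass η ν`, print's orientation), `η` is tautological on the `Δ`-part (P55-L02) and that part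
centralises `μ_N(B_N)` (P55-L02b), then EVERY candidate family `ρ` with `ρ_{B_N} = ν` is Kummer-determined on
`B_N` in the sense of abc-iut-L2-t4's `IsKummerDetermined` — i.e. the "second Kummer class" pins `ρ_{B_N}` to the
isomorphism `ν`.  [cite: MochizukiEtTh2009, Prop 5.5 p.327 (PDF p.101)] -/
theorem isKummerDetermined_of_thetaPair (P : ThetaSubquotientProj 𝔉) {η : 𝔉.HB → 𝔉.lDeltaModN 𝔉.BN}
    {ν : 𝔉.lDeltaModN 𝔉.BN ≃* 𝔉.muTorsion 𝔉.BN 𝔉.N}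
    (hK : FrobenioidThetaBiKummer.ThetaPairKummerClass 𝔉 η ν) (hη : EtaTautological 𝔉 P η)
    (hc : CyclotomeCentralUnderLDelta 𝔉 P) (ρ : RigidityFamily 𝔉) (hB : 𝔉.IsThetaSaturated 𝔉.BN)
    (hρB : ∀ x, ρ 𝔉.BN hB x = ν x) : IsKummerDetermined 𝔉 P ρ hB := by
  intro h hh
  obtain ⟨u, hu, hall⟩ := hK
  have hcomm : 𝔉.sgpCap (h : Aut (𝔉.base.obj 𝔉.BN)) * u = u * 𝔉.sgpCap (h : Aut (𝔉.base.obj 𝔉.BN)) :=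
    hc _ hh u hu
  have hcob : 𝔉.sgpCap (h : Aut (𝔉.base.obj 𝔉.BN)) * u * (𝔉.sgpCap (h : Aut (𝔉.base.obj 𝔉.BN)))⁻¹ * u⁻¹
      = 1 := by
    rw [hcomm, mul_inv_cancel_right, mul_inv_cancel]
  rw [hρB, hall h, hcob, one_mul, hη h hh]

/-! ### Prop. 5.5 — transport to arbitrary theta-saturated objects (proof p.328 l.2–11) -/

/-- **EtTh:Prop5.5/P55-L05, with «induce isomorphisms»** (p.328 (PDF p.102) l.2–8: «we may transport this
isomorphism from `S″` to an arbitrary `(l, N)`-theta-saturated `S ∈ Ob(C)` by means of linear morphisms `S″ → S`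
… which induce isomorphisms `(l·Δ_Θ)_{S″} ⊗ ℤ/Nℤ ⥲ (l·Δ_Θ)_S ⊗ ℤ/Nℤ`; …; `μ_N(S) ⥲ μ_N(S″)`»): abc-iut-L2-t4's
`LinearlyReachableFromBN` with both induced maps BIJECTIVE (the upgrade from onto/injective is a cardinality
count under Def. 5.4 (a)(b) at both ends — abc-iut-L2-t9's `ThetaSubquotient.modPowMap_bijective_of_card_eq` shape —
carried out in the companion).  [cite: MochizukiEtTh2009, Prop 5.5 proof p.328 (PDF p.102)] -/
def BijectivelyReachableFromBN : Prop :=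
  ∀ S : C, 𝔉.IsThetaSaturated S → ∃ φ : 𝔉.BN ⟶ S, 𝔉.IsLinear φ ∧
    Function.Bijective (𝔉.lDeltaModNMap φ) ∧ Function.Bijective (𝔉.muTorsionPull φ 𝔉.N)

/-- **EtTh:Prop5.5/P55-L06** (p.328 (PDF p.102) l.8–11: «— hence also a [functorial] isomorphism `(l·Δ_Θ)_S ⊗ ℤ/Nℤ
⥲ μ_N(S)`, which is independent of the choice of `S″`, `S‴` and the linear morphisms `S″ → S`, `S″ → S‴`
[precisely because of the original "functoriality" of the isomorphism for `S″`]»), typed at the one codomain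
`B_N` of the §5 data and INVERSE-FREE (graph form): for a theta-saturated `T` and two linear `φ, φ′ : B_N → T`,
the relation «`y = Δ-push(φ)(x)` and `μ-pull(φ)(u) = ρ₀(x)` for some `x`» is the same for `φ` and `φ′` — when the
induced maps are bijective (P55-L05) this says the two transported isomorphisms `μ-pull(φ)⁻¹ ∘ ρ₀ ∘ Δ-push(φ)⁻¹`
coincide.  OPEN (owner ∅): in print it rests on the functoriality among ALL `l·N`-codomains (P55-L04), for which
the §5 data carry only `B_N`.  [cite: MochizukiEtTh2009, Prop 5.5 proof p.328 (PDF p.102)] -/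
def TransportIndependent (ρ₀ : 𝔉.lDeltaModN 𝔉.BN ≃* 𝔉.muTorsion 𝔉.BN 𝔉.N) : Prop :=
  ∀ (T : C), 𝔉.IsThetaSaturated T → ∀ (φ φ' : 𝔉.BN ⟶ T), 𝔉.IsLinear φ → 𝔉.IsLinear φ' →
    ∀ (x x' : 𝔉.lDeltaModN 𝔉.BN) (u : 𝔉.muTorsion T 𝔉.N),
      𝔉.lDeltaModNMap φ x = 𝔉.lDeltaModNMap φ' x' →
        𝔉.muTorsionPull φ 𝔉.N u = ρ₀ x → 𝔉.muTorsionPull φ' 𝔉.N u = ρ₀ x'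

/-- **EtTh:Prop5.5/P55-L06b (law 1)**: the pull-back of units `O^×(T) → O^×(S)` of the §5 data (stub field
`TemperedFrobenioidStub.unitsPull`, §4 p.312 (PDF p.86)) is contravariantly FUNCTORIAL — used silently when the
isomorphism is transported along composites of linear morphisms (p.328 l.2–11).  A law of the abstract datum;
definitional at abc-iut-L2-t9's `TemperedFrobenioidStub.ofModel`.  [cite: MochizukiEtTh2009, Prop 5.5 proof p.328 (PDF p.102)] -/
def UnitsPullComp : Prop :=
  ∀ {S T U : C} (φ : S ⟶ T) (ψ : T ⟶ U), 𝔉.unitsPull (φ ≫ ψ) = (𝔉.unitsPull φ).comp (𝔉.unitsPull ψ)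

/-- **P55-L06b (law 2)**: `unitsPull (𝟙 S) = id`. [cite: MochizukiEtTh2009, Prop 5.5 proof p.328 (PDF p.102)] -/
def UnitsPullId : Prop :=
  ∀ S : C, 𝔉.unitsPull (𝟙 S) = MonoidHom.id _

/-- **P55-L06b (law 3)**: the transport `(l·Δ_Θ)_E → (l·Δ_Θ)_{E′}` of the theta subquotients along morphisms
of `D` (stub field `ThetaSubquotientStub.lDeltaMap`, p.327 (PDF p.101)) is covariantly FUNCTORIAL (abc-iut-L2-t9's
`ThetaSubquotientOfTempered` functor at the instance). [cite: MochizukiEtTh2009, §5 p.327 (PDF p.101)] -/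
def LDeltaMapComp : Prop :=
  ∀ {E E' E'' : D} (f : E ⟶ E') (g : E' ⟶ E''), 𝔉.lDeltaMap (f ≫ g) = (𝔉.lDeltaMap g).comp (𝔉.lDeltaMap f)

/-- **P55-L06b (law 4)**: `lDeltaMap (𝟙 E) = id`. [cite: MochizukiEtTh2009, §5 p.327 (PDF p.101)] -/
def LDeltaMapId : Prop :=
  ∀ E : D, 𝔉.lDeltaMap (𝟙 E) = MonoidHom.id _

/-! ### Thm. 5.6 — the typed inputs of the transport at `S₂ = B_N` (proof p.329 l.3–23) -/

/-- **EtTh:Thm5.6(i)/T56-L05** (p.329 (PDF p.103) l.3–6: «let `S₂ ∈ Ob(C)` be an `(l, N)`-theta-saturated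
`l·N`-codomain … such that `S₂^bs` is "characteristic" [i.e., its isomorphism class is preserved by arbitrary
self-equivalences of `D`]»): the predicate on an object `E` of the base category.  (At `E = B_N^bs`: Props. 2.4,
2.6; in abc-iut-L2-d4's files this enters as the base-isomorphism hypothesis `hbs` of Thm. 5.10 (i).)
[cite: MochizukiEtTh2009, Thm 5.6 proof p.329 (PDF p.103)] -/
def IsCharacteristicBase (E : D) : Prop :=
  ∀ Φ : D ≌ D, Nonempty (Φ.functor.obj E ≅ E)

/-- **EtTh:Thm5.6(i)/T56-L09d** (p.329 (PDF p.103) l.21–23; §4 p.312 (PDF p.86)): the pull-back of units along a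
LINEAR morphism `φ : S → T` is THE unit of `S` over `u` — `φ ≫ u = u_S ≫ φ` (the square of the functor `O^×(−)`
on linear morphisms; a law of the stub datum `unitsPull`, definitional at abc-iut-L2-t9's `ofModel`; cf.
abc-iut-L2-d4's naturality binder `hpull`).  [cite: MochizukiEtTh2009, §4 p.312 (PDF p.86)] -/
def UnitsPullSpec : Prop :=
  ∀ {S T : C} (φ : S ⟶ T), 𝔉.IsLinear φ → ∀ u : 𝔉.units T,
    φ ≫ (u : Aut T).hom = ((𝔉.unitsPull φ u : 𝔉.units S) : Aut S).hom ≫ φ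

/-- **T56-L09d, consequence**: along an ISOMORPHISM `β : X ⥲ Y` the cyclotome pull-back `μ_M(Y) → μ_M(X)` is
conjugation by `β` (`u ↦ β ≫ u ≫ β⁻¹`, i.e. `β.conjAut.symm`).  [cite: MochizukiEtTh2009, Thm 5.6 proof p.329 (PDF p.103)] -/
theorem muTorsionPull_iso_eq (hspec : UnitsPullSpec 𝔉) {X Y : C} (β : X ≅ Y) (M : ℕ) (u : 𝔉.muTorsion Y M) :
    β.conjAut (𝔉.muTorsionPull β.hom M u : Aut X) = (u : Aut Y) := by
  -- an isomorphism is linear: `deg_Fr(β) · deg_Fr(β⁻¹) = deg_Fr(id) = 1` ([FrdI] Rmk. 1.1.1)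
  have hlin : 𝔉.IsLinear β.hom := by
    have h := 𝔉.pre.degFr_comp β.hom β.inv
    rw [β.hom_inv_id, 𝔉.pre.degFr_id] at h
    have h' : ((𝔉.pre.degFr β.hom : ℕ+) : ℕ) * (𝔉.pre.degFr β.inv : ℕ) = 1 := by exact_mod_cast h.symm
    exact PNat.coe_injective (Nat.eq_one_of_mul_eq_one_right h')
  have hsq := hspec β.hom hlin ⟨u.1, u.2.1⟩
  apply Aut.ext
  rw [Iso.conjAut_hom, Iso.conj_apply]
  change β.inv ≫ ((𝔉.unitsPull β.hom ⟨u.1, u.2.1⟩ : 𝔉.units X) : Aut X).hom ≫ β.hom = (u : Aut Y).hom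
  rw [← hsq, Iso.inv_hom_id_assoc]

/-- **EtTh:Thm5.6(i)/T56-L09c** (p.329 (PDF p.103) l.1 «it follows from Propositions 2.4, 2.6 that `Ψ` preserves
"`(l·Δ_Θ)_{(−)}`"», with l.17–21): at `B_N`, the abstract transport `aΨ` of `(l·Δ_Θ) ⊗ ℤ/Nℤ` induced by `Ψ`
(abc-iut-L2-d4's PARAMETER of `Discharge/Sec5Thm56`), read back on `B_N` through `β : Ψ(B_N) ⥲ B_N`, is INDUCED BY
THE BASE TRANSPORT `θ` of `Aut_D(B_N^bs)` (the `θ` of abc-iut-L2-t4's `StrvTransport Ψ α e θ`, Thm. 4.4 (iv),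
normalised so that `Ψ(s^⊓_N)` transports to `e ≫ s^⊓_N` on the nose): `θ` preserves the part `P.pre` over
`(l·Δ_Θ)_{B_N}` and `Δ-push(β)(aΨ_{B_N}[proj g]) = [proj (θ g)]`.  Both sides come from the one outer automorphism
of `Π^tp_X` induced by `Ψ^bs` ([SemiAnbd] Prop. 3.2, T56-L02).  OPEN at the model (owner ∅; abc-iut-L2-t9
`thetaSubquotientStub` / `galoisSurj` naturality, W3-L2-01).  [cite: MochizukiEtTh2009, Thm 5.6 proof p.329 (PDF p.103)] -/
def DeltaTransportCompat (Ψ : C ≌ C) (β : Ψ.functor.obj 𝔉.BN ≅ 𝔉.BN)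
    (aΨ : ∀ S : C, 𝔉.lDeltaModN S ≃* 𝔉.lDeltaModN (Ψ.functor.obj S))
    (θ : Aut (𝔉.base.obj 𝔉.BN) ≃* Aut (𝔉.base.obj 𝔉.BN)) (P : ThetaSubquotientProj 𝔉) : Prop :=
  ∀ (g : Aut (𝔉.base.obj 𝔉.BN)) (hg : g ∈ P.pre (𝔉.base.obj 𝔉.BN)),
    ∃ hθg : θ g ∈ P.pre (𝔉.base.obj 𝔉.BN),
      𝔉.lDeltaModNMap β.hom (aΨ 𝔉.BN (QuotientGroup.mk (P.proj _ ⟨g, hg⟩))) =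
        QuotientGroup.mk (P.proj _ ⟨θ g, hθg⟩)

/-- **Coverage** (abc-iut-L2-t11's hypothesis `hcov` of `Discharge/Sec5RigidityGlue`, recorded here by name for
the assembly rows P55-A / T56-L09): the part of `H_{B_N}` over `(l·Δ_Θ)_{B_N}` maps ONTO `(l·Δ_Θ)_{B_N} ⊗ ℤ/Nℤ`
(§1 p.238 (PDF p.12): `Δ_Θ` is a quotient of `Π^tp_Ÿ`).  [cite: MochizukiEtTh2009, §1 p.238 (PDF p.12)] -/
def LDeltaCovered (P : ThetaSubquotientProj 𝔉) : Prop :=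
  ∀ x : 𝔉.lDeltaModN 𝔉.BN, ∃ (h : 𝔉.HB) (hh : (h : Aut (𝔉.base.obj 𝔉.BN)) ∈ P.pre (𝔉.base.obj 𝔉.BN)),
    (QuotientGroup.mk (P.proj _ ⟨h, hh⟩) : 𝔉.lDeltaModN 𝔉.BN) = x

end Thm56Sub

end ThetaFrobenioid

end Literature.AnabelianGeometry.EtaleTheta
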